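import Mathlib
import Literature.Probability.LatticeModels.SharpnessProofs
import HarnessLib

/-!
# Stub `stub_dirichletFormTent` of line `diffusive-branch-is-nonsaturation` (crux
# `PrecisionLaplacian.DirectCorrelationStableTail`, stmt-CriticalPhenomena-4799): the precision form
# of the tent is `O(R σ²)`

**Statement** (registered text, = `stub_dirichletFormTent` of the lead's skeleton).  For
`a ∈ ℓ¹(ℤ³)` with `Σ a = 0` (conservativity), `a ≥ 0` off `0` and `σ² = Σ_z a(z)‖z‖² < ∞`
(sup norm), the tent `h_R(x) = (1 − ‖x‖/R)₊` satisfies, for every `R ≥ 1`,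
`Σ_{x,y ∈ Λ_R} h_R(x) h_R(y) (−a(y−x)) ≤ 27 R σ²`  (`Λ_R = box 3 R = {−R,…,R}³`).

**Proof** (Ising-free; discrete Beurling–Deny).
* Reindexing `y = x + z` and conservativity `Σ a = 0` (`dirichletFormTent_inner`):
  `Σ_{y∈Λ_R} h(x)h(y)(−a(y−x)) = Σ'_z h(x)(h(x) − h(x+z)) a(z)` for every `x`.
* Swapping the finite `x`-sum with the `z`-series, the claim is termwise in `z`:
  `a(z) Σ_{x∈Λ_R} h(x)(h(x) − h(x+z)) ≤ 27 R a(z)‖z‖²` (both sides vanish at `z = 0`, `a(z) ≥ 0`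
  otherwise).
* Polarisation (`dirichletFormTent_polarisation`): over `S = Λ_R ∪ (Λ_R − z)`,
  `2 Σ h(x)(h(x) − h(x+z)) = Σ_S (h(x) − h(x+z))² + Σ_S h(x)² − Σ_S h(x+z)²`, the last two sums
  agree (translation invariance), `#S ≤ 2 (2R+1)³ ≤ 54 R³`, and the tent is `1/R`-Lipschitz for
  the sup norm: `(h_R(x) − h_R(x+z))² ≤ ‖z‖²/R²`.

Pure theorem file, no definitions, no `sorry`.  References: M. Fukushima, Y. Oshima, M. Takeda,
*Dirichlet forms and symmetric Markov processes* (2011), §1.1–1.2 (Beurling–Deny formula);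
folklore.
-/

noncomputable section

namespace Summit.CriticalPhenomena.Ising3DConformalLimit.Cruxes.DirectCorrelationStableTail.DiffusiveBranchIsNonsaturation

open scoped BigOperators
open Literature.Probability.LatticeModels

/-! ### Abstract part: a test function `h : ℤ³ → [0,1]` supported in a finite set -/

/-- For `0 ≤ h ≤ 1` and `a ∈ ℓ¹(ℤ³)`, the series `z ↦ h(x)(h(x) − h(x+z)) a(z)` is summable
(dominated by `|a|`). [folklore] -/
theorem dirichletFormTent_summable {h : Site 3 → ℝ} (h0 : ∀ x, 0 ≤ h x) (h1 : ∀ x, h x ≤ 1)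
    {a : Site 3 → ℝ} (ha : Summable a) (x : Site 3) :
    Summable (fun z => h x * (h x - h (x + z)) * a z) := by
  refine Summable.of_norm_bounded (g := fun z => |a z|) ha.abs (fun z => ?_)
  show ‖h x * (h x - h (x + z)) * a z‖ ≤ |a z|
  rw [Real.norm_eq_abs, abs_mul, abs_mul]
  have hx : |h x| ≤ 1 := abs_le.2 ⟨by linarith [h0 x], h1 x⟩
  have hxz : |h x - h (x + z)| ≤ 1 :=
    abs_le.2 ⟨by linarith [h0 x, h1 (x + z)], by linarith [h1 x, h0 (x + z)]⟩
  calc |h x| * |h x - h (x + z)| * |a z| ≤ 1 * 1 * |a z| :=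
        mul_le_mul_of_nonneg_right (mul_le_mul hx hxz (abs_nonneg _) zero_le_one) (abs_nonneg _)
    _ = |a z| := by ring

/-- Reindexing and conservativity: for `h` supported in `B` with `0 ≤ h ≤ 1` and `a ∈ ℓ¹(ℤ³)` with
`Σ a = 0`, `Σ_{y∈B} h(x)h(y)(−a(y−x)) = Σ'_z h(x)(h(x) − h(x+z)) a(z)`. [folklore] -/
theorem dirichletFormTent_inner {h : Site 3 → ℝ} {B : Finset (Site 3)} (hB : ∀ x ∉ B, h x = 0)
    (h0 : ∀ x, 0 ≤ h x) (h1 : ∀ x, h x ≤ 1) {a : Site 3 → ℝ} (ha : Summable a)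
    (hsum : ∑' y, a y = 0) (x : Site 3) :
    ∑ y ∈ B, h x * h y * -(a (y - x)) = ∑' z, h x * (h x - h (x + z)) * a z := by
  have hf : Summable (fun z => h x * h (x + z) * -(a z)) := by
    refine Summable.of_norm_bounded (g := fun z => |a z|) ha.abs (fun z => ?_)
    show ‖h x * h (x + z) * -(a z)‖ ≤ |a z|
    rw [Real.norm_eq_abs, abs_mul, abs_mul, abs_neg]
    have hx : |h x| ≤ 1 := abs_le.2 ⟨by linarith [h0 x], h1 x⟩
    have hxz : |h (x + z)| ≤ 1 := abs_le.2 ⟨by linarith [h0 (x + z)], h1 (x + z)⟩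
    calc |h x| * |h (x + z)| * |a z| ≤ 1 * 1 * |a z| :=
          mul_le_mul_of_nonneg_right (mul_le_mul hx hxz (abs_nonneg _) zero_le_one) (abs_nonneg _)
      _ = |a z| := by ring
  have e1 : ∑ y ∈ B, h x * h y * -(a (y - x)) = ∑' y, h x * h y * -(a (y - x)) := by
    refine (tsum_eq_sum fun y hy => ?_).symm
    show h x * h y * -(a (y - x)) = 0
    rw [hB y hy, mul_zero, zero_mul]
  have e2 := (Equiv.addLeft x).tsum_eq (fun y => h x * h y * -(a (y - x)))
  simp only [Equiv.coe_addLeft, add_sub_cancel_left] at e2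
  have e3 : (fun z => h x * (h x - h (x + z)) * a z) =
      fun z => h x * h x * a z + h x * h (x + z) * -(a z) := by
    funext z
    ring
  rw [e3, (ha.mul_left (h x * h x)).tsum_add hf, tsum_mul_left, hsum, mul_zero, zero_add, e1, ← e2]

/-- Polarisation bound: if `h` vanishes off `B` and `(h(x) − h(x+z))² ≤ ε` pointwise, then
`Σ_{x∈B} h(x)(h(x) − h(x+z)) ≤ #B · ε`.  Over `S = B ∪ (B − z)` one has
`2 Σ h(x)(h(x) − h(x+z)) = Σ_S (h(x) − h(x+z))² + Σ_S h(x)² − Σ_S h(x+z)²`, the last two sums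
agree by translation invariance, and `#S ≤ 2 #B`. [folklore (Beurling–Deny)] -/
theorem dirichletFormTent_polarisation {h : Site 3 → ℝ} {B : Finset (Site 3)}
    (hB : ∀ x ∉ B, h x = 0) (z : Site 3) {ε : ℝ} (hlip : ∀ x, (h x - h (x + z)) ^ 2 ≤ ε) :
    ∑ x ∈ B, h x * (h x - h (x + z)) ≤ B.card * ε := by
  classical
  have hε : 0 ≤ ε := (sq_nonneg _).trans (hlip 0)
  obtain ⟨S, hS⟩ : ∃ S : Finset (Site 3), S = B ∪ B.image (fun x => x - z) := ⟨_, rfl⟩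
  have hBS : B ⊆ S := by
    rw [hS]
    exact Finset.subset_union_left
  have hIS : B.image (fun x => x - z) ⊆ S := by
    rw [hS]
    exact Finset.subset_union_right
  have e1 : ∑ x ∈ B, h x * (h x - h (x + z)) = ∑ x ∈ S, h x * (h x - h (x + z)) :=
    Finset.sum_subset hBS fun x _ hx => by rw [hB x hx, zero_mul]
  have e2 : ∑ x ∈ S, h x ^ 2 = ∑ x ∈ B, h x ^ 2 :=
    (Finset.sum_subset hBS fun x _ hx => by rw [hB x hx]; ring).symm
  have e3 : ∑ x ∈ S, h (x + z) ^ 2 = ∑ x ∈ B, h x ^ 2 := by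
    rw [← Finset.sum_subset hIS]
    · rw [Finset.sum_image sub_left_injective.injOn]
      simp only [sub_add_cancel]
    · intro x _ hx
      have hxz : x + z ∉ B := fun hmem =>
        hx (Finset.mem_image.2 ⟨x + z, hmem, add_sub_cancel_right x z⟩)
      rw [hB _ hxz]
      ring
  have hcard : (S.card : ℝ) ≤ 2 * B.card := by
    have c1 : S.card ≤ B.card + (B.image (fun x => x - z)).card := by
      rw [hS]
      exact Finset.card_union_le _ _
    have c2 : (B.image (fun x => x - z)).card ≤ B.card := Finset.card_image_le
    have c3 : S.card ≤ 2 * B.card := by omega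
    exact_mod_cast c3
  have key : 2 * ∑ x ∈ B, h x * (h x - h (x + z)) = ∑ x ∈ S, (h x - h (x + z)) ^ 2 := by
    rw [e1, Finset.mul_sum]
    have hpt : ∀ x, 2 * (h x * (h x - h (x + z))) =
        (h x - h (x + z)) ^ 2 + (h x ^ 2 - h (x + z) ^ 2) := by
      intro x
      ring
    simp only [hpt]
    rw [Finset.sum_add_distrib, Finset.sum_sub_distrib, e2, e3, sub_self, add_zero]
  have hbound : ∑ x ∈ S, (h x - h (x + z)) ^ 2 ≤ S.card * ε :=
    (Finset.sum_le_sum fun x _ => hlip x).trans_eq (by rw [Finset.sum_const, nsmul_eq_mul])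
  have hcard' : (S.card : ℝ) * ε ≤ 2 * B.card * ε := mul_le_mul_of_nonneg_right hcard hε
  linarith

/-- The abstract estimate: a test function `h` with `0 ≤ h ≤ 1`, supported in `Λ_R` (`R ≥ 1`) and
with `(h(x) − h(x+z))² ≤ (‖z‖/R)²`, has precision form
`Σ_{x,y∈Λ_R} h(x)h(y)(−a(y−x)) ≤ 27 R Σ_z a(z)‖z‖²` for every conservative `a ∈ ℓ¹(ℤ³)`
(`Σ a = 0`, `a ≥ 0` off `0`) of finite second moment. [folklore (Beurling–Deny)] -/
theorem dirichletFormTent_of_lipschitz {h : Site 3 → ℝ} {R : ℕ} (hR : 1 ≤ R)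
    (hB : ∀ x ∉ box 3 R, h x = 0) (h0 : ∀ x, 0 ≤ h x) (h1 : ∀ x, h x ≤ 1)
    (hlip : ∀ x z, (h x - h (x + z)) ^ 2 ≤ (‖z‖ / R) ^ 2) {a : Site 3 → ℝ} (ha : Summable a)
    (hsum : ∑' y, a y = 0) (hpos : ∀ y, y ≠ 0 → 0 ≤ a y)
    (hσ : Summable (fun y : Site 3 => a y * ‖y‖ ^ 2)) :
    ∑ x ∈ box 3 R, ∑ y ∈ box 3 R, h x * h y * -(a (y - x)) ≤
      27 * R * ∑' y : Site 3, a y * ‖y‖ ^ 2 := by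
  have hg : ∀ x, Summable (fun z => h x * (h x - h (x + z)) * a z) :=
    fun x => dirichletFormTent_summable h0 h1 ha x
  have hR1 : (1 : ℝ) ≤ R := by exact_mod_cast hR
  have hR0 : (0 : ℝ) < R := by linarith
  have h27 : (2 * (R : ℝ) + 1) ^ 3 ≤ 27 * R ^ 3 :=
    calc (2 * (R : ℝ) + 1) ^ 3 ≤ (3 * R) ^ 3 := pow_le_pow_left₀ (by positivity) (by linarith) 3
      _ = 27 * R ^ 3 := by ring
  have hterm : ∀ z, ∑ x ∈ box 3 R, h x * (h x - h (x + z)) * a z ≤ 27 * R * (a z * ‖z‖ ^ 2) := by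
    intro z
    rcases eq_or_ne z 0 with rfl | hz
    · simp
    · have hkey : ∑ x ∈ box 3 R, h x * (h x - h (x + z)) ≤ 27 * R * ‖z‖ ^ 2 :=
        calc ∑ x ∈ box 3 R, h x * (h x - h (x + z))
            ≤ (box 3 R).card * (‖z‖ / R) ^ 2 :=
              dirichletFormTent_polarisation hB z (fun x => hlip x z)
          _ = (2 * R + 1) ^ 3 * ‖z‖ ^ 2 / R ^ 2 := by
              rw [card_box]
              push_cast
              ring
          _ ≤ 27 * R ^ 3 * ‖z‖ ^ 2 / R ^ 2 := by gcongr
          _ = 27 * R * ‖z‖ ^ 2 := by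
              rw [div_eq_iff (pow_pos hR0 2).ne']
              ring
      calc ∑ x ∈ box 3 R, h x * (h x - h (x + z)) * a z
          = (∑ x ∈ box 3 R, h x * (h x - h (x + z))) * a z := (Finset.sum_mul _ _ _).symm
        _ ≤ 27 * R * ‖z‖ ^ 2 * a z := mul_le_mul_of_nonneg_right hkey (hpos z hz)
        _ = 27 * R * (a z * ‖z‖ ^ 2) := by ring
  calc ∑ x ∈ box 3 R, ∑ y ∈ box 3 R, h x * h y * -(a (y - x))
      = ∑ x ∈ box 3 R, ∑' z, h x * (h x - h (x + z)) * a z :=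
        Finset.sum_congr rfl fun x _ => dirichletFormTent_inner hB h0 h1 ha hsum x
    _ = ∑' z, ∑ x ∈ box 3 R, h x * (h x - h (x + z)) * a z :=
        (Summable.tsum_finsetSum fun x _ => hg x).symm
    _ ≤ ∑' z, 27 * R * (a z * ‖z‖ ^ 2) :=
        Summable.tsum_le_tsum hterm (summable_sum fun x _ => hg x) (hσ.mul_left _)
    _ = 27 * R * ∑' y : Site 3, a y * ‖y‖ ^ 2 := tsum_mul_left

/-! ### The tent `h_R(x) = (1 − ‖x‖/R)₊` (sup norm on `ℤ³`) -/

/-- `0 ≤ h_R`. [folklore] -/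
theorem dirichletFormTent_tent_nonneg (R : ℕ) (x : Site 3) : 0 ≤ max 0 (1 - ‖x‖ / (R : ℝ)) :=
  le_max_left _ _

/-- `h_R ≤ 1`. [folklore] -/
theorem dirichletFormTent_tent_le_one (R : ℕ) (x : Site 3) : max 0 (1 - ‖x‖ / (R : ℝ)) ≤ 1 :=
  max_le zero_le_one (by linarith [div_nonneg (norm_nonneg x) (Nat.cast_nonneg (α := ℝ) R)])

/-- `h_R` vanishes off the box `Λ_R` (for `R ≥ 1`). [folklore] -/
theorem dirichletFormTent_tent_eq_zero {R : ℕ} (hR : 1 ≤ R) (x : Site 3) (hx : x ∉ box 3 R) :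
    max 0 (1 - ‖x‖ / (R : ℝ)) = 0 := by
  rw [mem_box_iff_supNorm_le, not_le] at hx
  have hR' : (0 : ℝ) < R := by exact_mod_cast Nat.lt_of_lt_of_le Nat.zero_lt_one hR
  have h1 : (R : ℝ) ≤ ‖x‖ := by
    rw [Site.norm_eq_supNorm]
    exact_mod_cast hx.le
  have h2 : 1 ≤ ‖x‖ / (R : ℝ) := by rwa [le_div_iff₀ hR', one_mul]
  exact max_eq_left (by linarith)

/-- The tent is `1/R`-Lipschitz for the sup norm: `(h_R(x) − h_R(x+z))² ≤ (‖z‖/R)²`. [folklore] -/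
theorem dirichletFormTent_tent_lipschitz (R : ℕ) (x z : Site 3) :
    (max 0 (1 - ‖x‖ / (R : ℝ)) - max 0 (1 - ‖x + z‖ / (R : ℝ))) ^ 2 ≤ (‖z‖ / R) ^ 2 := by
  have hR : (0 : ℝ) ≤ R := Nat.cast_nonneg R
  have h1 : |max 0 (1 - ‖x‖ / (R : ℝ)) - max 0 (1 - ‖x + z‖ / (R : ℝ))| ≤ ‖z‖ / R :=
    calc |max 0 (1 - ‖x‖ / (R : ℝ)) - max 0 (1 - ‖x + z‖ / (R : ℝ))|
        ≤ |(1 - ‖x‖ / (R : ℝ)) - (1 - ‖x + z‖ / (R : ℝ))| := by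
          rw [max_comm 0 (1 - ‖x‖ / (R : ℝ)), max_comm 0 (1 - ‖x + z‖ / (R : ℝ))]
          exact abs_max_sub_max_le_abs _ _ _
      _ = |‖x + z‖ - ‖x‖| / R := by
          rw [show (1 - ‖x‖ / (R : ℝ)) - (1 - ‖x + z‖ / (R : ℝ)) = (‖x + z‖ - ‖x‖) / R by ring,
            abs_div, abs_of_nonneg hR]
      _ ≤ ‖z‖ / R := by
          gcongr
          simpa [add_sub_cancel_left] using abs_norm_sub_norm_le (x + z) x
  calc (max 0 (1 - ‖x‖ / (R : ℝ)) - max 0 (1 - ‖x + z‖ / (R : ℝ))) ^ 2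
      = |max 0 (1 - ‖x‖ / (R : ℝ)) - max 0 (1 - ‖x + z‖ / (R : ℝ))| ^ 2 := (sq_abs _).symm
    _ ≤ (‖z‖ / R) ^ 2 := pow_le_pow_left₀ (abs_nonneg _) h1 2

/-! ### The registered stub -/

/-- **Stub `stub_dirichletFormTent` (the precision form of the tent is `O(R σ²)`; conservativity
only, Ising-free).**  For `a ∈ ℓ¹(ℤ³)` with `Σ a = 0`, `a ≥ 0` off `0` and
`σ² = Σ a(z)‖z‖² < ∞`, the tent `h_R(x) = (1 − ‖x‖/R)₊` has
`Σ_{x,y ∈ Λ_R} h_R(x)h_R(y)(−a(y−x)) ≤ 27 R σ²`.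
Proof: `dirichletFormTent_of_lipschitz` applied to the tent (`dirichletFormTent_tent_*`).
[folklore (Beurling–Deny / discrete Dirichlet forms)] -/
theorem stub_dirichletFormTent :
    ∀ (a : Site 3 → ℝ), Summable a → (∑' y, a y) = 0 → (∀ y, y ≠ 0 → 0 ≤ a y) →
      Summable (fun y : Site 3 => a y * ‖y‖ ^ 2) →
      ∀ R : ℕ, 1 ≤ R →
        ∑ x ∈ box 3 R, ∑ y ∈ box 3 R, max 0 (1 - ‖x‖ / (R : ℝ)) * max 0 (1 - ‖y‖ / (R : ℝ)) * -(a (y - x)) ≤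
          27 * R * ∑' y : Site 3, a y * ‖y‖ ^ 2 :=
  fun _ ha hsum hpos hσ R hR =>
    dirichletFormTent_of_lipschitz (h := fun x => max 0 (1 - ‖x‖ / (R : ℝ))) hR
      (dirichletFormTent_tent_eq_zero hR) (dirichletFormTent_tent_nonneg R)
      (dirichletFormTent_tent_le_one R) (dirichletFormTent_tent_lipschitz R) ha hsum hpos hσ

end Summit.CriticalPhenomena.Ising3DConformalLimit.Cruxes.DirectCorrelationStableTail.DiffusiveBranchIsNonsaturation

end
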